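import Mathlib
import HarnessLib
import Summits.ValiantsHypothesis.ValiantsHypothesis.Theorems.MonotoneRestorationOrbitRestorationLinearVolumeQPSeparatingFamily
import Summits.ValiantsHypothesis.ValiantsHypothesis.Theorems.MonotoneRestorationOrbitRestorationQPPerNotNarrow

/-!
# A single linear-size pattern per level whose hom polynomial is NOT in the polylog narrow span; the open stub
# `stub_lvNarrowSpan` with `VNP` in place of `VP` is FALSE

Route MonotoneRestoration, aside R1 = `OrbitRestorationLinearVolumeQP` (stmt-ValiantsHypothesis-18294), line `birth`, open stub
`stub_lvNarrowSpan` (every `VP` family of R1's class lies level by level in the ℂ-span of the homomorphism polynomials of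
bipartite patterns of treewidth `≤ (log₂ n + c)^c`).  The unconditional separating family of
`…LinearVolumeQPSeparatingFamily.lean` (one bipartite pattern `F_n` with `≤ n + c₀` rows, columns and edges per level,
`VNP`, polylog-separating) gives, with the tree's K2/K3 (`qpOrbit_of_mem_narrowSpan`) and the orbit-form
Dawar–Wilsenach pipeline:

* `exists_single_pattern_not_mem_narrowSpan` — THERE IS a pattern family `F_n` with `≤ n + c₀` rows, columns and edges
  whose hom polynomials form a `VNP` family and, for EVERY `c`, are NOT all in the narrow span of treewidth
  `(log₂ n + c)^c` (unconditionally; the classical non-member is the permanent, `perPoly_not_mem_narrowSpan`, whose hom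
  expansion has super-polynomial DIMENSION — here the dimension is ONE and the volume linear);
* `not_lvNarrowSpan_vnp` — **`stub_lvNarrowSpan` with `VNP` in place of `VP` is FALSE**: the `VP` hypothesis of the open
  stub is essential unless `VP = VNP` (K1-currency twin of `not_orbitRestorationLinearVolumeQP_vnp`).

Honest framing: tightness; the stub (Dwivedi–Pago–Seppelt Outlook Q3 at quasi-polynomial scale), R1, the crux and
VP ≠ VNP remain open.
-/

noncomputable section

-- `Summit.ValiantsHypothesis.ValiantsHypothesis.…` is the tree's single-conjunct layout (Sub = Summit).
set_option linter.dupNamespace false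

namespace Summit.ValiantsHypothesis.ValiantsHypothesis.Theorems

namespace OrbitRestorationLinearVolumeQPVHStrength

open MvPolynomial
open Summit.ValiantsHypothesis.ValiantsHypothesis.Theses.MonotoneRestoration
open Literature.Computability.AlgebraicComplexity
open Literature.ModelTheory.FiniteModelTheory

/-- **A linear-size single pattern outside every polylog narrow span.**  There are `c₀` and bipartite multigraph patterns
`F_n = (Fin (a n) ⊔ Fin (b n), E n)` with `a n, b n, |E n| ≤ n + c₀`, whose homomorphism polynomials form a `VNP` family,
such that for every `c` it is NOT the case that `hom_{F_n,n}` lies in the span of the hom polynomials of patterns of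
treewidth `≤ (log₂ n + c)^c` at every `n` (membership at all levels would give quasi-polynomial-orbit symmetric circuits,
`qpOrbit_of_mem_narrowSpan`, which the family's polylog separation forbids). [cite: DawarWilsenach2025, Thm 7.2; DawarPagoSeppelt2025, §5] -/
theorem exists_single_pattern_not_mem_narrowSpan :
    ∃ (c₀ : ℕ) (a b : ℕ → ℕ) (E : (n : ℕ) → Multiset (Fin (a n) × Fin (b n))),
      (∀ n, a n ≤ n + c₀) ∧ (∀ n, b n ≤ n + c₀) ∧ (∀ n, Multiset.card (E n) ≤ n + c₀) ∧
      IsVNPFamily (fun n => homPoly (E n) n ℂ) ∧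
      ∀ c : ℕ, ¬ ∀ n : ℕ, homPoly (E n) n ℂ ∈ Submodule.span ℂ
        {p : MvPolynomial (Fin n × Fin n) ℂ | ∃ (a b : ℕ) (E : Multiset (Fin a × Fin b)),
          Literature.Combinatorics.SimpleGraph.treewidth
              (SimpleGraph.fromRel fun u v : Fin a ⊕ Fin b =>
                ∃ e ∈ E, u = Sum.inl e.1 ∧ v = Sum.inr e.2) ≤ (Nat.log 2 n + c) ^ c ∧
            p = homPoly E n ℂ} := by
  obtain ⟨c₀, a, b, E, ha, hb, hE, hVNP, hsep⟩ := exists_separating_linearVolume_vnp_family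
  refine ⟨c₀, a, b, E, ha, hb, hE, hVNP, fun c hmem => ?_⟩
  exact not_qpOrbitSymmetric_of_polylogSeparating (fun n => homPoly (E n) n ℂ) hsep
    ⟨c + 3, fun n => OrbitRestorationQPHomPolyClose.qpOrbit_of_mem_narrowSpan (fun n => homPoly (E n) n ℂ) c hmem n⟩

/-- **`stub_lvNarrowSpan` with `VNP` in place of `VP` is FALSE** (unconditionally): not every `VNP` family of R1's class
(poly-dimension combination of hom polynomials of linear-volume bipartite patterns) lies, for one constant and every level,
in the narrow span of treewidth `(log₂ n + c)^c`.  Witness: the single-pattern family of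
`exists_single_pattern_not_mem_narrowSpan` (dimension `1`, volume `≤ (2c₀+2)(n+1)`). [cite: DawarWilsenach2025, Thm 7.2; DwivediPagoSeppelt2026, Outlook Q3] -/
theorem not_lvNarrowSpan_vnp :
    ¬ ∀ f : (n : ℕ) → MvPolynomial (Fin n × Fin n) ℂ, IsVNPFamily f →
      (∃ (c : ℕ) (m : ℕ → ℕ) (a b : (n : ℕ) → Fin (m n) → ℕ)
          (E : (n : ℕ) → (i : Fin (m n)) → Multiset (Fin (a n i) × Fin (b n i)))
          (α : (n : ℕ) → Fin (m n) → ℂ),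
        (∀ n, m n ≤ (n + 2) ^ c) ∧ (∀ n i, a n i + b n i ≤ c * (n + 1)) ∧
          ∀ n, f n = ∑ i : Fin (m n), MvPolynomial.C (α n i) * homPoly (E n i) n ℂ) →
      ∃ c : ℕ, ∀ n : ℕ, f n ∈ Submodule.span ℂ
        {p : MvPolynomial (Fin n × Fin n) ℂ | ∃ (a b : ℕ) (E : Multiset (Fin a × Fin b)),
          Literature.Combinatorics.SimpleGraph.treewidth
              (SimpleGraph.fromRel fun u v : Fin a ⊕ Fin b =>
                ∃ e ∈ E, u = Sum.inl e.1 ∧ v = Sum.inr e.2) ≤ (Nat.log 2 n + c) ^ c ∧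
            p = homPoly E n ℂ} := by
  intro h
  obtain ⟨c₀, a, b, E, ha, hb, -, hVNP, hnot⟩ := exists_single_pattern_not_mem_narrowSpan
  obtain ⟨c, hc⟩ := h (fun n => homPoly (E n) n ℂ) hVNP
    ⟨2 * c₀ + 2, fun _ => 1, fun n _ => a n, fun n _ => b n, fun n _ => E n, fun _ _ => 1,
      fun n => Nat.one_le_pow _ _ (by omega), fun n _ => by have h1 := ha n; have h2 := hb n; nlinarith,
      fun n => by simp⟩
  exact hnot c hc

end OrbitRestorationLinearVolumeQPVHStrength

end Summit.ValiantsHypothesis.ValiantsHypothesis.Theorems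

end
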